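import Summits.Ventures.Crystal3D.Theorems.StickyWulffConstantCoaxialWallLawSeamSealedRow
import Summits.Ventures.Crystal3D.Theorems.StickyWulffConstantCoaxialWallLawSeamUnionCoreCapRefuted
import Summits.Ventures.Crystal3D.Theorems.StickyWulffConstantGenericWallFloorShellRowCertBridgeB
import Summits.Ventures.Crystal3D.Theorems.StickyWulffConstantGenericWallFloorEndBallClassOps
import HarnessLib

/-!
# Z-TERM KIT: rational cubic coordinates, cube normals and `{111}` reflections, the module Gram obstruction, closure invariants
# (crux `CoaxialWallLaw`, stmt-Ventures-19481; line `WallLedgerF`, skeleton 'CoaxialWallLawCertificates' v8.3; toward the refutation of the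
# registered input `stub_unionCoreSealedCapWin3 : TailResidue.UnionCoreSealedCapWin₃ (2 * Real.sqrt 6)` by the UNFLOORED PAYER TERM)

HONEST FRAMING. Venture `Summits/Ventures/Crystal3D` (cell `crystal3d-full`), helper `--supports` stmt-Ventures-19481.  Plumbing only, for the sequel
'…SeamSealedRowZTerm*': there an explicit 21-ball window `Y` (payer `0` the target of FIVE narrow movers, eight single-contact junk balls) has
`sealedSummand₃ = 5 > 2√6`, because `sealedPool₃` floors the pool at `3` only for `b ≠ z`.  This file provides
* §1 `cubicVecQ` algebra (`cubicVecQ_add/sub/neg`, `inner_cubicVecQ`, `dist_sq_cubicVecQ`, `cubicVecQ_injective`, `slotSite_eq_cubicVecQ`);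
* §2 cube normals `cubeNormal c` (unit `{111}` normals in cubic coordinates): `inner_cubicVecQ_cubeNormal`, `isMenuNormal_cubeNormal`, `isMenuNormal_map_self`;
* §3 the `{111}` reflection `cubeRefl c` on rational cubic vectors: `cubeRefl_cubicVecQ` (`reflQ c a = a − (2(a·c)/3)•c`, no divisibility hypothesis);
(part B, '…SeamSealedRowZTermKitB': the module Gram obstruction, closure invariants, counting lemmas for the cap table.)
WHAT THIS IS NOT: no statement about any stub; F-C1 not moved.
-/

noncomputable section

namespace Summit.Ventures.Crystal3D.Theorems

namespace ZTerm

open Summit.Ventures.Crystal3D Finset NearIdentity TailResidue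
open scoped InnerProductSpace

/-! ### §1 Rational cubic vectors -/

/-- Cubic coordinates of `cubicVecQ a`. -/
theorem cubicCoords_cubicVecQ (a : Fin 3 → ℚ) : cubicCoords (cubicVecQ a) = fun i => ((a i : ℚ) : ℝ) / Real.sqrt 2 := by
  rw [cubicVecQ_eq_ofCubic, cubicCoords_ofCubic]

/-- `cubicVecQ` is additive. -/
theorem cubicVecQ_add (a b : Fin 3 → ℚ) : cubicVecQ (a + b) = cubicVecQ a + cubicVecQ b := by
  apply cubicCoords_injective
  rw [cubicCoords_add, cubicCoords_cubicVecQ, cubicCoords_cubicVecQ, cubicCoords_cubicVecQ]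
  ext i; simp only [Pi.add_apply, Rat.cast_add]; ring

/-- `cubicVecQ` respects subtraction. -/
theorem cubicVecQ_sub (a b : Fin 3 → ℚ) : cubicVecQ (a - b) = cubicVecQ a - cubicVecQ b := by
  apply cubicCoords_injective
  rw [cubicCoords_sub, cubicCoords_cubicVecQ, cubicCoords_cubicVecQ, cubicCoords_cubicVecQ]
  ext i; simp only [Pi.sub_apply, Rat.cast_sub]; ring

/-- `cubicVecQ 0 = 0`. -/
theorem cubicVecQ_zero : cubicVecQ (0 : Fin 3 → ℚ) = 0 := by
  have h := cubicVecQ_sub (0 : Fin 3 → ℚ) 0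
  rw [sub_self, sub_self] at h
  exact h

/-- `cubicVecQ` respects negation. -/
theorem cubicVecQ_neg (a : Fin 3 → ℚ) : cubicVecQ (-a) = -cubicVecQ a := by
  have h := cubicVecQ_sub 0 a
  rw [zero_sub, cubicVecQ_zero, zero_sub] at h
  exact h

/-- `cubicVecQ` respects rational scaling. -/
theorem cubicVecQ_smul (r : ℚ) (a : Fin 3 → ℚ) : cubicVecQ (r • a) = ((r : ℚ) : ℝ) • cubicVecQ a := by
  apply cubicCoords_injective
  rw [cubicCoords_smul, cubicCoords_cubicVecQ, cubicCoords_cubicVecQ]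
  ext i; simp only [Pi.smul_apply, smul_eq_mul, Rat.cast_mul]; ring

/-- The computable dot product of two rational triples (= `dotProduct`, but reducible by `decide +kernel`). -/
def qdot (a b : Fin 3 → ℚ) : ℚ := a 0 * b 0 + a 1 * b 1 + a 2 * b 2

/-- `qdot` is the dot product. -/
theorem qdot_eq_dotProduct (a b : Fin 3 → ℚ) : qdot a b = a ⬝ᵥ b := by
  simp [qdot, dotProduct, Fin.sum_univ_three]

/-- `x/√2 · y/√2 = xy/2`. -/
theorem div_sqrt_two_mul (x y : ℝ) : x / Real.sqrt 2 * (y / Real.sqrt 2) = x * y / 2 := by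
  rw [div_mul_div_comm, Real.mul_self_sqrt (by norm_num)]

/-- `x/√3 · y/√3 = xy/3`. -/
theorem div_sqrt_three_mul (x y : ℝ) : x / Real.sqrt 3 * (y / Real.sqrt 3) = x * y / 3 := by
  rw [div_mul_div_comm, Real.mul_self_sqrt (by norm_num)]

/-- `x/√2 · y/√3 = xy/√6`. -/
theorem div_sqrt_two_mul_div_sqrt_three (x y : ℝ) : x / Real.sqrt 2 * (y / Real.sqrt 3) = x * y / Real.sqrt 6 := by
  rw [div_mul_div_comm, ← Real.sqrt_mul (by norm_num)]; norm_num

/-- **Inner products of rational cubic vectors**: `⟪cubicVecQ a, cubicVecQ b⟫ = (a·b)/2`. -/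
theorem inner_cubicVecQ (a b : Fin 3 → ℚ) : ⟪cubicVecQ a, cubicVecQ b⟫_ℝ = ((qdot a b : ℚ) : ℝ) / 2 := by
  rw [cubicVecQ_eq_ofCubic, cubicVecQ_eq_ofCubic, inner_ofCubic]
  simp only [dotProduct, Fin.sum_univ_three, qdot, Rat.cast_add, Rat.cast_mul, div_sqrt_two_mul]
  ring

/-- Squared norm of a rational cubic vector. -/
theorem norm_sq_cubicVecQ' (a : Fin 3 → ℚ) : ‖cubicVecQ a‖ ^ 2 = ((qdot a a : ℚ) : ℝ) / 2 := by
  rw [← real_inner_self_eq_norm_sq, inner_cubicVecQ]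

/-- **Squared distances of rational cubic vectors**: `dist² = |a − b|²/2`. -/
theorem dist_sq_cubicVecQ (a b : Fin 3 → ℚ) : dist (cubicVecQ a) (cubicVecQ b) ^ 2 = ((qdot (a - b) (a - b) : ℚ) : ℝ) / 2 := by
  rw [dist_eq_norm, ← cubicVecQ_sub, norm_sq_cubicVecQ']

/-- `dist = 1` iff `|a − b|² = 2`. -/
theorem dist_cubicVecQ_eq_one_iff (a b : Fin 3 → ℚ) : dist (cubicVecQ a) (cubicVecQ b) = 1 ↔ qdot (a - b) (a - b) = 2 := by
  have h := dist_sq_cubicVecQ a b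
  constructor
  · intro h1
    rw [h1, one_pow] at h
    have : ((qdot (a - b) (a - b) : ℚ) : ℝ) = 2 := by linarith
    exact_mod_cast this
  · intro h2
    rw [h2] at h
    have h' : dist (cubicVecQ a) (cubicVecQ b) ^ 2 = 1 := by rw [h]; push_cast; ring
    have hd : 0 ≤ dist (cubicVecQ a) (cubicVecQ b) := dist_nonneg
    nlinarith [h', hd]

/-- `1 ≤ dist` iff `2 ≤ |a − b|²`. -/
theorem one_le_dist_cubicVecQ_iff (a b : Fin 3 → ℚ) : 1 ≤ dist (cubicVecQ a) (cubicVecQ b) ↔ 2 ≤ qdot (a - b) (a - b) := by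
  have h := dist_sq_cubicVecQ a b
  have hd : 0 ≤ dist (cubicVecQ a) (cubicVecQ b) := dist_nonneg
  constructor
  · intro h1
    have : (1 : ℝ) ≤ dist (cubicVecQ a) (cubicVecQ b) ^ 2 := by nlinarith
    rw [h] at this
    have : (2 : ℝ) ≤ ((qdot (a - b) (a - b) : ℚ) : ℝ) := by linarith
    exact_mod_cast this
  · intro h2
    have h2' : (2 : ℝ) ≤ ((qdot (a - b) (a - b) : ℚ) : ℝ) := by exact_mod_cast h2
    have : (1 : ℝ) ≤ dist (cubicVecQ a) (cubicVecQ b) ^ 2 := by rw [h]; linarith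
    nlinarith

/-- `dist ≤ r` (for `0 ≤ r`) iff `|a − b|² ≤ 2 r²`. -/
theorem dist_cubicVecQ_le_iff (a b : Fin 3 → ℚ) {r : ℚ} (hr : 0 ≤ r) : dist (cubicVecQ a) (cubicVecQ b) ≤ r ↔ qdot (a - b) (a - b) ≤ 2 * r * r := by
  have h := dist_sq_cubicVecQ a b
  have hd : 0 ≤ dist (cubicVecQ a) (cubicVecQ b) := dist_nonneg
  have hr' : (0 : ℝ) ≤ (r : ℝ) := by exact_mod_cast hr
  constructor
  · intro h1
    have : dist (cubicVecQ a) (cubicVecQ b) ^ 2 ≤ (r : ℝ) ^ 2 := pow_le_pow_left₀ hd h1 2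
    rw [h] at this
    have : ((qdot (a - b) (a - b) : ℚ) : ℝ) ≤ 2 * r * r := by nlinarith
    exact_mod_cast this
  · intro h2
    have h2' : ((qdot (a - b) (a - b) : ℚ) : ℝ) ≤ 2 * r * r := by exact_mod_cast h2
    have : dist (cubicVecQ a) (cubicVecQ b) ^ 2 ≤ (r : ℝ) ^ 2 := by rw [h]; nlinarith
    exact (pow_le_pow_iff_left₀ hd hr' two_ne_zero).1 this

/-- `dist < 1` excluded iff... : `dist ≠ 1` from `|a-b|² ≠ 2`. -/
theorem dist_cubicVecQ_ne_one (a b : Fin 3 → ℚ) (h : qdot (a - b) (a - b) ≠ 2) : dist (cubicVecQ a) (cubicVecQ b) ≠ 1 :=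
  fun h1 => h ((dist_cubicVecQ_eq_one_iff a b).1 h1)

/-- `cubicVecQ` is injective. -/
theorem cubicVecQ_injective : Function.Injective cubicVecQ := by
  intro a b h
  have hc := congrArg cubicCoords h
  rw [cubicCoords_cubicVecQ, cubicCoords_cubicVecQ] at hc
  ext i
  have hi := congrFun hc i
  have hs : Real.sqrt 2 ≠ 0 := by positivity
  have : ((a i : ℚ) : ℝ) = ((b i : ℚ) : ℝ) := by
    field_simp at hi
    linarith [hi]
  exact_mod_cast this

/-- The integer slot table as rational triples. -/
def slotQ (k : Fin 12) : Fin 3 → ℚ := fun i => (slotInt k i : ℚ)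

/-- **Slots are rational cubic vectors**: `slotSite k = cubicVecQ (slotQ k)`. -/
theorem slotSite_eq_cubicVecQ (k : Fin 12) : slotSite k = cubicVecQ (slotQ k) := by
  apply cubicCoords_injective
  rw [cubicCoords_slotSite, cubicCoords_cubicVecQ]
  ext i; simp [slotVec, slotQ]

/-- Membership in `fccSlots` through the table. -/
theorem mem_fccSlots_iff_slotQ {w : EuclideanSpace ℝ (Fin 3)} : w ∈ fccSlots ↔ ∃ k : Fin 12, w = cubicVecQ (slotQ k) := by
  constructor
  · intro hw
    obtain ⟨k, rfl⟩ := exists_slotSite_eq hw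
    exact ⟨k, slotSite_eq_cubicVecQ k⟩
  · rintro ⟨k, rfl⟩
    rw [← slotSite_eq_cubicVecQ]; exact slotSite_mem k

/-! ### §2 Cube normals -/

/-- The cube vertex `c` as a rational triple. -/
def cubeQ (c : Fin 8) : Fin 3 → ℚ := fun i => (cubeInt c i : ℚ)

/-- **The unit `{111}` normal** along the cube vertex `c`: cubic coordinates `cubeInt c / √3`. -/
def cubeNormal (c : Fin 8) : EuclideanSpace ℝ (Fin 3) := ofCubic fun j => (cubeInt c j : ℝ) / Real.sqrt 3

/-- Cubic coordinates of a cube normal. -/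
theorem cubicCoords_cubeNormal (c : Fin 8) : cubicCoords (cubeNormal c) = fun j => (cubeInt c j : ℝ) / Real.sqrt 3 := cubicCoords_ofCubic _

/-- `qdot (cubeQ c) (cubeQ c) = 3`. -/
theorem qdot_cubeQ_self (c : Fin 8) : qdot (cubeQ c) (cubeQ c) = 3 := by
  fin_cases c <;> simp [qdot, cubeQ, cubeInt] <;> norm_num

/-- Cube normals are unit vectors. -/
theorem norm_cubeNormal (c : Fin 8) : ‖cubeNormal c‖ = 1 := by
  have h3 : ‖cubeNormal c‖ ^ 2 = 1 := by
    rw [cubeNormal, norm_sq_ofCubic]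
    have hq := cubeVec_dot_self c
    simp only [dotProduct, Fin.sum_univ_three, cubeVec] at hq
    simp only [dotProduct, Fin.sum_univ_three, div_sqrt_three_mul]
    linarith
  have hn : 0 ≤ ‖cubeNormal c‖ := norm_nonneg _
  nlinarith [h3, hn]

/-- **Rational vector against cube normal**: `⟪cubicVecQ a, cubeNormal c⟫ = (a·c)/√6`. -/
theorem inner_cubicVecQ_cubeNormal (a : Fin 3 → ℚ) (c : Fin 8) : ⟪cubicVecQ a, cubeNormal c⟫_ℝ = ((qdot a (cubeQ c) : ℚ) : ℝ) / Real.sqrt 6 := by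
  rw [cubicVecQ_eq_ofCubic, cubeNormal, inner_ofCubic]
  simp only [dotProduct, Fin.sum_univ_three, qdot, cubeQ, Rat.cast_add, Rat.cast_mul, Rat.cast_intCast, div_sqrt_two_mul_div_sqrt_three]
  ring

/-- `√(2/3) = 2/√6`. -/
theorem sqrt_two_thirds_eq : Real.sqrt (2 / 3) = 2 / Real.sqrt 6 := by
  rw [eq_div_iff (by positivity), show (6 : ℝ) = (2 / 3) * 9 by norm_num, Real.sqrt_mul (by norm_num), show (9 : ℝ) = 3 ^ 2 by norm_num,
    Real.sqrt_sq (by norm_num), ← mul_assoc, Real.mul_self_sqrt (by norm_num)]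
  norm_num

/-- Reading the sign of `⟪cubicVecQ a, cubeNormal c⟫` off the table. -/
theorem inner_cubicVecQ_cubeNormal_pos_iff (a : Fin 3 → ℚ) (c : Fin 8) : 0 < ⟪cubicVecQ a, cubeNormal c⟫_ℝ ↔ 0 < qdot a (cubeQ c) := by
  rw [inner_cubicVecQ_cubeNormal, div_pos_iff_of_pos_right (by positivity)]
  exact_mod_cast Iff.rfl

/-- Non-positivity of `⟪cubicVecQ a, cubeNormal c⟫` off the table. -/
theorem inner_cubicVecQ_cubeNormal_nonpos_iff (a : Fin 3 → ℚ) (c : Fin 8) : ⟪cubicVecQ a, cubeNormal c⟫_ℝ ≤ 0 ↔ qdot a (cubeQ c) ≤ 0 := by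
  rw [← not_lt, inner_cubicVecQ_cubeNormal_pos_iff, not_lt]

/-- `⟪cubicVecQ a, cubeNormal c⟫ = √(2/3)` iff `a·c = 2`. -/
theorem inner_cubicVecQ_cubeNormal_eq_sqrt_iff (a : Fin 3 → ℚ) (c : Fin 8) : ⟪cubicVecQ a, cubeNormal c⟫_ℝ = Real.sqrt (2 / 3) ↔ qdot a (cubeQ c) = 2 := by
  rw [inner_cubicVecQ_cubeNormal, sqrt_two_thirds_eq]
  have h6 : Real.sqrt 6 ≠ 0 := by positivity
  rw [div_left_inj' h6]
  exact_mod_cast Iff.rfl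

/-- The value set of a cube normal on the slots (table). -/
theorem qdot_slotQ_cubeQ (k : Fin 12) (c : Fin 8) : qdot (slotQ k) (cubeQ c) = 0 ∨ qdot (slotQ k) (cubeQ c) = 2 ∨ qdot (slotQ k) (cubeQ c) = -2 := by
  have h := sdot3_slotInt_cubeInt k c
  have e : qdot (slotQ k) (cubeQ c) = (sdot3 (slotInt k) (cubeInt c) : ℚ) := by simp [qdot, slotQ, cubeQ, sdot3]
  rw [e]
  rcases h with h | h | h <;> rw [h] <;> norm_num

/-- **Cube normals are menu normals of the identity frame.** -/
theorem isMenuNormal_cubeNormal (c : Fin 8) : IsMenuNormal (LinearIsometryEquiv.refl ℝ (EuclideanSpace ℝ (Fin 3))) (cubeNormal c) := by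
  refine ⟨norm_cubeNormal c, fun w hw => ?_⟩
  obtain ⟨k, rfl⟩ := mem_fccSlots_iff_slotQ.1 hw
  simp only [LinearIsometryEquiv.coe_refl, id_eq]
  rw [inner_cubicVecQ_cubeNormal, sqrt_two_thirds_eq]
  rcases qdot_slotQ_cubeQ k c with h | h | h <;> rw [h]
  · left; simp
  · right; left; push_cast; ring
  · right; right; push_cast; ring

/-- A frame carries the menu normals of the identity frame along. -/
theorem isMenuNormal_map_self (G : EuclideanSpace ℝ (Fin 3) ≃ₗᵢ[ℝ] EuclideanSpace ℝ (Fin 3)) {m : EuclideanSpace ℝ (Fin 3)}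
    (hm : IsMenuNormal (LinearIsometryEquiv.refl ℝ (EuclideanSpace ℝ (Fin 3))) m) : IsMenuNormal G (G m) := by
  refine ⟨by rw [G.norm_map]; exact hm.1, fun w hw => ?_⟩
  rw [LinearIsometryEquiv.inner_map_map]
  simpa using hm.2 w hw

/-! ### §3 The `{111}` reflections on rational cubic vectors -/

/-- The reflection in the `{111}` plane with unit normal `cubeNormal c`. -/
def cubeRefl (c : Fin 8) : EuclideanSpace ℝ (Fin 3) ≃ₗᵢ[ℝ] EuclideanSpace ℝ (Fin 3) := (ℝ ∙ cubeNormal c)ᗮ.reflection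

/-- The same reflection on the rational table: `a ↦ a − (2(a·c)/3) c`. -/
def reflQ (c : Fin 8) (a : Fin 3 → ℚ) : Fin 3 → ℚ := a - (2 * qdot a (cubeQ c) / 3) • cubeQ c

/-- **`cubeRefl c (cubicVecQ a) = cubicVecQ (reflQ c a)`** (no divisibility hypothesis). -/
theorem cubeRefl_cubicVecQ (c : Fin 8) (a : Fin 3 → ℚ) : cubeRefl c (cubicVecQ a) = cubicVecQ (reflQ c a) := by
  rw [cubeRefl, Submodule.reflection_orthogonal_apply, Submodule.reflection_singleton_apply, real_inner_comm, inner_cubicVecQ_cubeNormal]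
  have hn : ((‖cubeNormal c‖ : ℝ) : ℝ) ^ 2 = 1 := by rw [norm_cubeNormal]; norm_num
  simp only [RCLike.ofReal_real_eq_id, id_eq] at *
  rw [hn, div_one, neg_sub, two_smul]
  apply cubicCoords_injective
  rw [cubicCoords_sub, cubicCoords_add, cubicCoords_smul, cubicCoords_cubicVecQ, cubicCoords_cubeNormal, cubicCoords_cubicVecQ]
  ext k
  simp only [reflQ, Pi.sub_apply, Pi.add_apply, Pi.smul_apply, smul_eq_mul, Rat.cast_sub, Rat.cast_mul, Rat.cast_div, Rat.cast_ofNat, cubeQ,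
    Rat.cast_intCast]
  have h6 : Real.sqrt 6 = Real.sqrt 2 * Real.sqrt 3 := by
    rw [show (6 : ℝ) = 2 * 3 by norm_num, Real.sqrt_mul (by norm_num)]
  have hs2 : Real.sqrt 2 ≠ 0 := by positivity
  have hs3 : Real.sqrt 3 ≠ 0 := by positivity
  have h33 : Real.sqrt 3 ^ 2 = 3 := Real.sq_sqrt (by norm_num)
  rw [h6]
  field_simp
  rw [h33]
  ring

end ZTerm

end Summit.Ventures.Crystal3D.Theorems

end
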